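import Summits.MatrixMultiplication.MatrixMultiplication.Theorems.ObstructionDescentUniversalOccurrenceTwoRectangleTallPairArith

set_option linter.dupNamespace false
set_option autoImplicit false

/-!
# Universal occurrence — two rectangles, FOUR-ROW TYPES `(2N-2k-6, 2k+2, 2, 2)`, part U: arithmetic of the quad-front design (decomp-mm · lens 3 · gen 43)

Route `route-MatrixMultiplication-ObstructionDescent` (sub-problem `MatrixMultiplication`, `ω(ℂ) = 2`); SUPPORT for the crux
`NoOccurrenceObstruction` (`P_O`, item `stmt-MatrixMultiplication-29040`) through the universal-occurrence programme (NODE-g29…g43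
of the decomp-mm cell, lens 3).  Nothing here proves `ω = 2` or closes an item; no `def`, no `sorry`, standard axioms.

**This file (elementary, shape-free).**  `sum_slots_quad_eq`: a slot function vanishing from slot `2k+4` on is the sum of its four
front values and its `k` pair values; `sum_quadColouring_eq` / `sum_quadIndicator_eq`: the colouring `g = (0,1,2,3, 0,1, 0,1, …)` has
`Σ g = k + 6` and takes each of the values `2`, `3` exactly once; `indicator4_once`: reading an indicator count of one;
`quadFront_local_configurations`: the LOCAL ALPHABET of the front pair of height `4` — columns `(A₀,B₀,A₁,B₁) ‖ (B₂,A₂,B₃,A₃)`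
injective with letters `< 4`, the twist equalities `B₁ = A₃`, `B₃ = A₁`, the letters `2`, `3` present among `A₀,A₁,A₂,A₃` and not
doubled at `A₀, A₂` ⟹ twin (`B₂ = A₀`, `A₂ = B₀`) or anti-twin (`B₂ = B₀`, `A₂ = A₀`, and then `A₀ + B₀ = 1`); the parity law with
remainder is `antiPairs_card_add_sum` of part Q.

[cite: BurgisserIkenmeyer2011, §3.4 (Prop. 3.4), Thm. 4.4] [cite: BurgisserIkenmeyer2017, §5, Thm. 5.9 (proof of (2)), eq. (3.4)]
-/

noncomputable section

open scoped BigOperators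

namespace Summit.MatrixMultiplication.MatrixMultiplication.Theorems.ObstructionCalculus

/-! ### §1 Slot sums with a front block of four -/

/-- A slot function vanishing from slot `2k+4` on: four front values plus `k` pairs. [folklore] -/
theorem sum_slots_quad_eq {N k : ℕ} (hk : 2 * k + 4 ≤ N) (a : Fin N → ℕ)
    (h : ∀ s : Fin N, 2 * k + 4 ≤ (s : ℕ) → a s = 0) :
    ∑ s, a s = ((if h0 : 0 < N then a ⟨0, h0⟩ else 0) + (if h1 : 1 < N then a ⟨1, h1⟩ else 0) +
        (if h2 : 2 < N then a ⟨2, h2⟩ else 0) + (if h3 : 3 < N then a ⟨3, h3⟩ else 0)) +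
      ∑ j ∈ Finset.range k, ((if hj : 2 * j + 4 < N then a ⟨2 * j + 4, hj⟩ else 0) +
        (if hj : 2 * j + 5 < N then a ⟨2 * j + 5, hj⟩ else 0)) := by
  classical
  let a' : ℕ → ℕ := fun n => if hn : n < N then a ⟨n, hn⟩ else 0
  have ha' : ∀ s : Fin N, a s = a' s := fun s => by simp [a']
  have h1 : ∑ s : Fin N, a s = ∑ i ∈ Finset.range N, a' i := by
    rw [← Fin.sum_univ_eq_sum_range]
    exact Finset.sum_congr rfl (fun s _ => ha' s)
  have h2 : ∑ i ∈ Finset.range (4 + 2 * k), a' i = ∑ i ∈ Finset.range N, a' i := by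
    apply Finset.sum_subset (fun x hx => Finset.mem_range.2 (lt_of_lt_of_le (Finset.mem_range.1 hx) (by omega)))
    intro x hx hx2
    rw [Finset.mem_range] at hx hx2
    simp only [a', dif_pos hx]
    exact h _ (by simp; omega)
  rw [h1, ← h2, Finset.sum_range_add, sum_range_double]
  have h3 : ∑ x ∈ Finset.range 4, a' x = a' 0 + a' 1 + a' 2 + a' 3 := by
    simp [Finset.sum_range_succ]
  rw [h3]
  congr 1
  apply Finset.sum_congr rfl
  intro j hj
  rw [show 4 + 2 * j = 2 * j + 4 by ring, show 4 + (2 * j + 1) = 2 * j + 5 by ring]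

/-- The quad colouring `g = (0,1,2,3,0,1,0,1,…)` (`k` pairs) has total `k + 6`. [folklore] -/
theorem sum_quadColouring_eq {N k : ℕ} (hk : 2 * k + 4 ≤ N) (a : Fin N → ℕ)
    (ha : ∀ s : Fin N, a s = if (s : ℕ) < 4 then (s : ℕ)
      else if ((s : ℕ) < 2 * k + 4 ∧ (s : ℕ) % 2 = 1) then 1 else 0) : ∑ s, a s = k + 6 := by
  rw [sum_slots_quad_eq hk a (fun s hs => by rw [ha, if_neg (by omega), if_neg (by omega)])]
  have h : ∀ j ∈ Finset.range k, ((if hj : 2 * j + 4 < N then a ⟨2 * j + 4, hj⟩ else 0) +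
      (if hj : 2 * j + 5 < N then a ⟨2 * j + 5, hj⟩ else 0)) = 1 := by
    intro j hj
    rw [Finset.mem_range] at hj
    rw [dif_pos (by omega), dif_pos (by omega), ha, ha, if_neg (by dsimp only; omega),
      if_neg (by dsimp only; omega), if_neg (by dsimp only; omega), if_pos (by dsimp only; omega)]
  rw [Finset.sum_congr rfl h, dif_pos (by omega), dif_pos (by omega), dif_pos (by omega), dif_pos (by omega),
    ha, ha, ha, ha]
  simp
  omega

/-- The quad colouring takes each of the values `2`, `3` exactly once. [folklore] -/
theorem sum_quadIndicator_eq {N k : ℕ} (hk : 2 * k + 4 ≤ N) (g : Fin N → ℕ)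
    (hg : ∀ s : Fin N, g s = if (s : ℕ) < 4 then (s : ℕ)
      else if ((s : ℕ) < 2 * k + 4 ∧ (s : ℕ) % 2 = 1) then 1 else 0) (c : ℕ) (hc : 2 ≤ c) (hc' : c < 4) :
    ∑ s, (if g s = c then 1 else 0) = 1 := by
  have hz : ∀ s : Fin N, 2 * k + 4 ≤ (s : ℕ) → (if g s = c then 1 else 0) = 0 := by
    intro s hs; rw [hg]; split_ifs <;> omega
  rw [sum_slots_quad_eq hk _ hz]
  have h : ∀ j ∈ Finset.range k,
      ((if hj : 2 * j + 4 < N then (if g ⟨2 * j + 4, hj⟩ = c then 1 else 0) else 0) +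
      (if hj : 2 * j + 5 < N then (if g ⟨2 * j + 5, hj⟩ = c then 1 else 0) else 0)) = 0 := by
    intro j hj
    rw [Finset.mem_range] at hj
    have h4 : g ⟨2 * j + 4, by omega⟩ = 0 := by rw [hg]; dsimp only; split_ifs <;> omega
    have h5 : g ⟨2 * j + 5, by omega⟩ = 1 := by rw [hg]; dsimp only; split_ifs <;> omega
    rw [dif_pos (by omega), dif_pos (by omega), h4, h5, if_neg (by omega), if_neg (by omega)]
  have g0 : g ⟨0, by omega⟩ = 0 := by rw [hg]; dsimp only; split_ifs <;> omega
  have g1 : g ⟨1, by omega⟩ = 1 := by rw [hg]; dsimp only; split_ifs <;> omega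
  have g2 : g ⟨2, by omega⟩ = 2 := by rw [hg]; dsimp only; split_ifs <;> omega
  have g3 : g ⟨3, by omega⟩ = 3 := by rw [hg]; dsimp only; split_ifs <;> omega
  rw [Finset.sum_congr rfl h, dif_pos (by omega), dif_pos (by omega), dif_pos (by omega), dif_pos (by omega),
    g0, g1, g2, g3, Finset.sum_const_zero, add_zero]
  split_ifs <;> omega

/-! ### §2 The front alphabet -/

/-- Reading an indicator count of one over four letters: the value occurs, and not at both the first and the third place. [folklore] -/
theorem indicator4_once {a b c d n : ℕ}
    (h : (if a = n then 1 else 0) + (if b = n then 1 else 0) + (if c = n then 1 else 0) + (if d = n then 1 else 0) = 1) :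
    (a = n ∨ b = n ∨ c = n ∨ d = n) ∧ (a = n → c = n → False) := by
  constructor
  · by_contra hc
    simp only [not_or] at hc
    obtain ⟨h1, h2, h3, h4⟩ := hc
    rw [if_neg h1, if_neg h2, if_neg h3, if_neg h4] at h
    omega
  · intro ha hc
    rw [if_pos ha, if_pos hc] at h
    split_ifs at h <;> omega

set_option maxHeartbeats 400000 in
/-- **Local alphabet of the front pair of height 4.**  Columns `(A₀,B₀,A₁,B₁) ‖ (B₂,A₂,B₃,A₃)`, injective, letters `< 4`, twist
equalities `B₁ = A₃`, `B₃ = A₁`, the letters `2` and `3` present among `A₀,A₁,A₂,A₃` and not at both `A₀, A₂`: twin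
(`B₂ = A₀ ∧ A₂ = B₀`) or anti-twin (`B₂ = B₀ ∧ A₂ = A₀`, forcing `A₀ + B₀ = 1`). [folklore] -/
theorem quadFront_local_configurations (A0 B0 A1 B1 B2 A2 B3 A3 : ℕ)
    (hA0 : A0 < 4) (hB0 : B0 < 4) (hA1 : A1 < 4) (hB1 : B1 < 4) (hB2 : B2 < 4) (hA2 : A2 < 4)
    (c01 : A0 ≠ B0) (c02 : A0 ≠ A1) (c03 : A0 ≠ B1) (c12 : B0 ≠ A1) (c13 : B0 ≠ B1) (c23 : A1 ≠ B1)
    (c45 : B2 ≠ A2) (c46 : B2 ≠ B3) (c47 : B2 ≠ A3) (c56 : A2 ≠ B3) (c57 : A2 ≠ A3)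
    (v1 : B1 = A3) (v3 : B3 = A1)
    (eA2 : A0 = 2 ∨ A1 = 2 ∨ A2 = 2 ∨ A3 = 2) (eA3 : A0 = 3 ∨ A1 = 3 ∨ A2 = 3 ∨ A3 = 3)
    (xA2 : A0 = 2 → A2 = 2 → False) (xA3 : A0 = 3 → A2 = 3 → False) :
    (B2 = A0 ∧ A2 = B0) ∨ (B2 = B0 ∧ A2 = A0 ∧ A0 + B0 = 1) := by
  subst v1 v3
  by_cases ht : B2 = A0
  · left
    exact ⟨ht, by omega⟩
  · right
    have e2 : B2 = B0 := by omega
    have e2' : A2 = A0 := by omega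
    refine ⟨e2, e2', ?_⟩
    have n2 : A0 ≠ 2 := fun h => xA2 h (e2'.trans h)
    have n3 : A0 ≠ 3 := fun h => xA3 h (e2'.trans h)
    omega

end Summit.MatrixMultiplication.MatrixMultiplication.Theorems.ObstructionCalculus
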